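import Literature.Probability.RandomPlanarGeometry.HexSAW
import HarnessLib

/-!
# The SAW law `P_{x,δ}` of an embedded graph as a normalised finite sum; closure of `Ω_δ` under adjacency

Small dictionary lemmas for the objects of `HexSAW.lean` (Duminil-Copin–Smirnov, Ann. of Math. 175
(2012) §4: `P_{x,δ}(γ) ∝ x^{ℓ(γ)}` on the SAWs of `Ω_δ`), used when an event of the law is
estimated by bare combinatorics on walks:

* `embWeight_apply` — with finitely many SAWs, `embWeight S = Σ_{γ ∈ S} x^{ℓ(γ)}` (a `Finset` sum);
* `embLaw_apply_le_one` — `P_{x,δ}(S) ≤ 1` always (also in the junk regimes);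
* `embLaw_apply_le_ofReal` — if `Σ_{γ ∈ S} x^{ℓ(γ)} ≤ C · Σ_γ x^{ℓ(γ)}` then `P_{x,δ}(S) ≤ C`;
* `mem_embMeshDomain_of_adj` — the discrete domain `Ω_δ` (union of the largest components of the
  mesh graph) is closed under mesh adjacency; `isChain_embDomainGraph_of_isChain` — hence a chain of
  mesh edges starting in `Ω_δ` is a chain of the graph `Ω_δ`.

No new definitions. Deliberately NOT here: finiteness of the SAWs (depends on the lattice; for the
honeycomb lattice see the users), any estimate of a specific event.
-/

noncomputable section

open MeasureTheory
open scoped ENNReal Classical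

namespace Literature.Probability.RandomPlanarGeometry.SAW

variable {V : Type*} {G : SimpleGraph V} {emb : V → ℂ} {Ω : Set ℂ} {δ x : ℝ} {a b : V}

/-- **The SAW measure is a finite sum of weighted Diracs**: for finitely many SAWs,
`embWeight S = Σ_{γ ∈ S} x^{ℓ(γ)}`. [cite: DuminilCopinSmirnov2012, §4 (before Conjecture 1)] -/
theorem embWeight_apply [Fintype (EmbDomainSAW G emb Ω δ a b)] (S : Set (EmbDomainSAW G emb Ω δ a b)) :
    embWeight G emb Ω δ x a b S =
      ∑ γ ∈ (Finset.univ : Finset (EmbDomainSAW G emb Ω δ a b)).filter (fun γ => γ ∈ S),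
        ENNReal.ofReal (x ^ γ.vertexCount) := by
  rw [embWeight, Measure.sum_apply _ MeasurableSpace.measurableSet_top, tsum_fintype,
    Finset.sum_filter]
  refine Finset.sum_congr rfl fun γ _ => ?_
  rw [Measure.smul_apply, smul_eq_mul, Measure.dirac_apply' _ MeasurableSpace.measurableSet_top]
  by_cases h : γ ∈ S
  · rw [Set.indicator_of_mem h, Pi.one_apply, mul_one, if_pos h]
  · rw [Set.indicator_of_notMem h, mul_zero, if_neg h]

/-- **`P_{x,δ}(S) ≤ 1`** for every event, in every regime (the law is `Z⁻¹ •` weight with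
`Z` the total weight; junk `0` or `∞` normalisations only make it smaller).
[cite: DuminilCopinSmirnov2012, §4 (before Conjecture 1)] -/
theorem embLaw_apply_le_one (S : Set (EmbDomainSAW G emb Ω δ a b)) :
    embLaw G emb Ω δ x a b S ≤ 1 := by
  rw [embLaw, Measure.smul_apply, smul_eq_mul]
  calc (embWeight G emb Ω δ x a b Set.univ)⁻¹ * embWeight G emb Ω δ x a b S
      ≤ (embWeight G emb Ω δ x a b Set.univ)⁻¹ * embWeight G emb Ω δ x a b Set.univ :=
        mul_le_mul_right (measure_mono (Set.subset_univ _)) _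
    _ ≤ 1 := ENNReal.inv_mul_le_one _

/-- **Estimating an event by combinatorics on walks**: if the `x`-weighted count of the SAWs in
`S` is at most `C` times the total `x`-weighted count (`x ≥ 0`, `C ≥ 0`, finitely many SAWs),
then `P_{x,δ}(S) ≤ C`. [cite: DuminilCopinSmirnov2012, §4 (before Conjecture 1)] -/
theorem embLaw_apply_le_ofReal [Fintype (EmbDomainSAW G emb Ω δ a b)] (hx : 0 ≤ x)
    {S : Set (EmbDomainSAW G emb Ω δ a b)} {C : ℝ} (hC : 0 ≤ C)
    (h : ∑ γ ∈ (Finset.univ : Finset (EmbDomainSAW G emb Ω δ a b)).filter (fun γ => γ ∈ S),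
        x ^ γ.vertexCount ≤ C * ∑ γ : EmbDomainSAW G emb Ω δ a b, x ^ γ.vertexCount) :
    embLaw G emb Ω δ x a b S ≤ ENNReal.ofReal C := by
  have hnn : ∀ γ : EmbDomainSAW G emb Ω δ a b, 0 ≤ x ^ γ.vertexCount := fun γ => pow_nonneg hx _
  have hS : embWeight G emb Ω δ x a b S = ENNReal.ofReal
      (∑ γ ∈ (Finset.univ : Finset (EmbDomainSAW G emb Ω δ a b)).filter (fun γ => γ ∈ S),
        x ^ γ.vertexCount) := by
    rw [embWeight_apply, ENNReal.ofReal_sum_of_nonneg fun γ _ => hnn γ]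
  have hU : embWeight G emb Ω δ x a b Set.univ =
      ENNReal.ofReal (∑ γ : EmbDomainSAW G emb Ω δ a b, x ^ γ.vertexCount) := by
    rw [embWeight_apply, ENNReal.ofReal_sum_of_nonneg fun γ _ => hnn γ]
    simp
  set Z : ℝ := ∑ γ : EmbDomainSAW G emb Ω δ a b, x ^ γ.vertexCount with hZ
  have hZ0 : 0 ≤ Z := Finset.sum_nonneg fun γ _ => hnn γ
  rw [embLaw, Measure.smul_apply, smul_eq_mul, hS, hU]
  rcases hZ0.eq_or_lt with hZ00 | hZpos
  · -- no mass at all: the event has weight `0`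
    have hle : ∑ γ ∈ (Finset.univ : Finset (EmbDomainSAW G emb Ω δ a b)).filter (fun γ => γ ∈ S),
        x ^ γ.vertexCount ≤ 0 := by
      refine h.trans ?_
      rw [← hZ00, mul_zero]
    rw [ENNReal.ofReal_of_nonpos hle, mul_zero]
    exact zero_le
  · have hZne : ENNReal.ofReal Z ≠ 0 := by
      rw [Ne, ENNReal.ofReal_eq_zero, not_le]; exact hZpos
    calc (ENNReal.ofReal Z)⁻¹ * ENNReal.ofReal (∑ γ ∈ (Finset.univ : Finset
          (EmbDomainSAW G emb Ω δ a b)).filter (fun γ => γ ∈ S), x ^ γ.vertexCount)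
        ≤ (ENNReal.ofReal Z)⁻¹ * ENNReal.ofReal (C * Z) :=
          mul_le_mul_right (ENNReal.ofReal_le_ofReal h) _
      _ = ENNReal.ofReal C * ((ENNReal.ofReal Z)⁻¹ * ENNReal.ofReal Z) := by
          rw [ENNReal.ofReal_mul hC]; ring
      _ = ENNReal.ofReal C := by
          rw [ENNReal.inv_mul_cancel hZne ENNReal.ofReal_ne_top, mul_one]

/-- **`Ω_δ` is closed under mesh adjacency**: a mesh vertex adjacent (in the mesh graph) to a
vertex of the discrete domain lies in the discrete domain (it is in the same component).
[folklore] -/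
theorem mem_embMeshDomain_of_adj {u u' : V} (hu : u ∈ embMeshDomain G emb Ω δ)
    (hu' : u' ∈ embMeshVertices emb Ω δ) (hadj : (embMeshGraph G emb Ω δ).Adj u u') :
    u' ∈ embMeshDomain G emb Ω δ := by
  simp only [embMeshDomain, Set.mem_iUnion, Set.mem_image] at hu ⊢
  obtain ⟨C, hC, ⟨u₀, hu₀⟩, hu₀C, rfl⟩ := hu
  refine ⟨C, hC, ⟨u', hu'⟩, ?_, rfl⟩
  rw [SimpleGraph.ConnectedComponent.mem_supp_iff] at hu₀C ⊢
  rw [← hu₀C]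
  refine SimpleGraph.ConnectedComponent.connectedComponentMk_eq_of_adj ?_
  simp only [SimpleGraph.comap_adj, Function.Embedding.subtype_apply]
  exact hadj.symm

/-- **A chain of mesh edges starting in `Ω_δ` is a chain of `Ω_δ`.** If consecutive elements of `l`
are related by `R`, every `R`-step is a mesh edge into a mesh vertex, and the first element lies in
the discrete domain, then `l` is a chain of the graph `Ω_δ` (each vertex is dragged into the
largest component by `mem_embMeshDomain_of_adj`). [folklore] -/
theorem isChain_embDomainGraph_of_isChain {R : V → V → Prop}
    (hR : ∀ u v, R u v → (embMeshGraph G emb Ω δ).Adj u v ∧ v ∈ embMeshVertices emb Ω δ) :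
    ∀ {l : List V}, l.IsChain R → (∀ h : l ≠ [], l.head h ∈ embMeshDomain G emb Ω δ) →
      l.IsChain (embDomainGraph G emb Ω δ).Adj
  | [], _, _ => List.IsChain.nil
  | [u], _, _ => List.IsChain.singleton u
  | u :: v :: l, hc, hh => by
    rw [List.isChain_cons_cons] at hc ⊢
    have hu : u ∈ embMeshDomain G emb Ω δ := hh (List.cons_ne_nil _ _)
    obtain ⟨hadj, hv⟩ := hR u v hc.1
    have hv' : v ∈ embMeshDomain G emb Ω δ := mem_embMeshDomain_of_adj hu hv hadj
    exact ⟨(embDomainGraph_adj_iff G emb).2 ⟨hadj, hu, hv'⟩,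
      isChain_embDomainGraph_of_isChain hR hc.2 fun _ => hv'⟩

end Literature.Probability.RandomPlanarGeometry.SAW

end
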